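import Summits.CriticalPhenomena.SAWScalingLimit.Theorems.SAWLeftRightFKGLeftRightFKGNotchedBoxWalkAux
import Summits.CriticalPhenomena.SAWScalingLimit.Theorems.SAWLeftRightFKGLeftRightFKGDefs
import HarnessLib

/-!
# Crux `LeftRightFKG` (stmt-CriticalPhenomena-11232), line `corner-localisation` (v9):
every NOTCHED box is a crux domain (`stub_notchedBoxWalk`, tool T9b)

For walls `x₀ < x_s < x₁`, `y₀ + 2 < y₁` let `C` be the notched-box walk of
`Families.NotchedBox.stub_notchedBoxWalkAux` (the counter-clockwise boundary walk of
`[x₀, x₁] × [y₀, y₁]` with the unit spur `(x_s, y₀) → s → (x_s, y₀)`, `s = (x_s, y₀ + 1)`, spliced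
in).  We identify the crux's domain `dom C 1 = {z | wind(C, z) ≠ 0}` (definitionally
`Negative.Rect.Ω C`) at mesh `1`:

* the trace of `C` lies on the four wall lines and the spur line `{re = x_s, im ≤ y₀ + 1}`
  (`range_subset`), so a site of `box ∖ {s}` is off the trace and has the winding number of its
  face centre, `1` (`wind_pt_eq_one`); a site on the trace (wall points, the notch `s`) has the junk
  value `0`, and a site strictly outside the rectangle has the winding number `0` of its exterior
  face (`Negative.wind_poly_probeL_eq_zero_of_not_mem`) — so the mesh vertices are exactly
  `box ∖ {s}` (`meshVertices_eq`);
* the closed unit segment between lattice neighbours of `box ∖ {s}` misses the trace (it lies in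
  the open rectangle, and could only meet the spur line in an endpoint equal to `s`), so the
  winding number is `1` all along it and the two sites are mesh-adjacent (`meshGraph_adj`);
* `box ∖ {s}` is connected in the mesh graph (every site is joined through its column to the top
  row `y = y₁ - 1`, which avoids the bottom-row notch since `y₀ + 2 < y₁`, and the top row is a
  path; `preconnected`), so the discrete domain is the whole of `box ∖ {s}`
  (`Literature.Probability.Percolation.meshDomain_eq_meshVertices_of_preconnected`) and adjacency
  in `discreteDomainGraph (dom C 1) 1` is lattice adjacency inside `box ∖ {s}`.

Everything is elementary. [folklore]
-/

open Set Complex Literature.Probability.LatticeModels Literature.Probability.RandomPlanarGeometry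
  Literature.Topology.PlaneTopology
open Summit.CriticalPhenomena.SAWScalingLimit.Theorems.LeftRightFKG.Negative

namespace Summit.CriticalPhenomena.SAWScalingLimit.Theorems.LeftRightFKG.Families

namespace NotchedBox

section Winding

variable {x₀ x₁ y₀ y₁ x_s : ℤ} {C : (zdGraph 2).Walk (bx x₀ y₀) (bx x₀ y₀)}

/-- The trace of the notched-box walk lies on the wall lines and on the spur line
`{re = x_s, im ≤ y₀ + 1}`. [folklore] -/
theorem range_subset
    (hch : List.IsChain (fun p q : Site 2 => ((p 1 = y₀ ∧ q 1 = y₀) ∨ (p 0 = x₁ ∧ q 0 = x₁) ∨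
      (p 1 = y₁ ∧ q 1 = y₁) ∨ (p 0 = x₀ ∧ q 0 = x₀)) ∨
      (p 0 = x_s ∧ q 0 = x_s ∧ p 1 ≤ y₀ + 1 ∧ q 1 ≤ y₀ + 1)) (bx x₀ y₀ :: C.support.tail)) :
    range (poly (bx x₀ y₀) C.support.tail) ⊆
      Rect.Cbd x₀ x₁ y₀ y₁ ∪ {z | z.re = x_s ∧ z.im ≤ (y₀ : ℝ) + 1} := by
  refine range_poly_subset_of_isChain _ _ (Or.inl (Or.inl rfl)) (hch.imp fun p q h => ?_)
  rcases h with h | ⟨hp, hq, hp1, hq1⟩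
  · exact (Rect.segment_subset_Cbd h).trans subset_union_left
  · intro z hz
    refine Or.inr ⟨by rw [re_eq_of_mem_segment (by rw [hp, hq]) hz, hp], ?_⟩
    have him := (im_mem_of_mem_segment hz).2
    rw [pt_im, pt_im] at him
    have hp1' : ((p 1 : ℤ) : ℝ) ≤ y₀ + 1 := by exact_mod_cast hp1
    have hq1' : ((q 1 : ℤ) : ℝ) ≤ y₀ + 1 := by exact_mod_cast hq1
    exact him.trans (max_le hp1' hq1')

/-- Sites of the notched box are off the trace. [folklore] -/
theorem pt_not_mem_range
    (hch : List.IsChain (fun p q : Site 2 => ((p 1 = y₀ ∧ q 1 = y₀) ∨ (p 0 = x₁ ∧ q 0 = x₁) ∨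
      (p 1 = y₁ ∧ q 1 = y₁) ∨ (p 0 = x₀ ∧ q 0 = x₀)) ∨
      (p 0 = x_s ∧ q 0 = x_s ∧ p 1 ≤ y₀ + 1 ∧ q 1 ≤ y₀ + 1)) (bx x₀ y₀ :: C.support.tail))
    {x : Site 2} (hx : x ∈ Rect.box x₀ x₁ y₀ y₁ \ {bx x_s (y₀ + 1)}) :
    pt x ∉ range (poly (bx x₀ y₀) C.support.tail) := by
  intro h
  rcases range_subset hch h with h | ⟨hre, him⟩
  · exact Rect.Cbd_subset_compl_Rint h (Rect.pt_mem_Rint_of_box hx.1)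
  · obtain ⟨⟨⟨-, -⟩, h3, -⟩, hxs⟩ := hx
    rw [pt_re, Int.cast_inj] at hre
    rw [pt_im] at him
    have him' : x 1 ≤ y₀ + 1 := by exact_mod_cast him
    apply hxs
    rw [mem_singleton_iff, eq_bx x]
    exact congrArg₂ bx hre (by omega)

/-- **Sites of the notched box have winding number `1`.** [folklore] -/
theorem wind_pt_eq_one
    (hch : List.IsChain (fun p q : Site 2 => ((p 1 = y₀ ∧ q 1 = y₀) ∨ (p 0 = x₁ ∧ q 0 = x₁) ∨
      (p 1 = y₁ ∧ q 1 = y₁) ∨ (p 0 = x₀ ∧ q 0 = x₀)) ∨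
      (p 0 = x_s ∧ q 0 = x_s ∧ p 1 ≤ y₀ + 1 ∧ q 1 ≤ y₀ + 1)) (bx x₀ y₀ :: C.support.tail))
    (hwin : ∀ m k : ℤ, x₀ ≤ m → m < x₁ → y₀ ≤ k → k < y₁ →
      wind (fun t : ℝ => (poly (bx x₀ y₀) C.support.tail).extend t - probeL m k) = 1)
    {x : Site 2} (hx : x ∈ Rect.box x₀ x₁ y₀ y₁ \ {bx x_s (y₀ + 1)}) :
    wind (fun t : ℝ => (poly (bx x₀ y₀) C.support.tail).extend t - pt x) = 1 := by
  rw [wind_eq_wind_probeL C (pt_not_mem_range hch hx), pt_re, pt_im, Int.floor_intCast,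
    Int.floor_intCast]
  obtain ⟨⟨h1, h2⟩, h3, h4⟩ := hx.1
  exact hwin _ _ h1.le h2 h3.le h4

/-- **Sites off the notched box have winding number `0`**: the notch and the wall points are on
the trace (junk value `0`), the sites strictly outside the rectangle lie in exterior faces.
[folklore] -/
theorem wind_pt_eq_zero (hb : ∀ x ∈ C.support, (x₀ ≤ x 0 ∧ x 0 ≤ x₁) ∧ (y₀ ≤ x 1 ∧ x 1 ≤ y₁))
    (hcomp : ∀ i j : ℤ, x₀ ≤ i → i ≤ x₁ → y₀ ≤ j → j ≤ y₁ → (i = x₀ ∨ i = x₁ ∨ j = y₀ ∨ j = y₁) →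
      bx i j ∈ C.support)
    (hs : bx x_s (y₀ + 1) ∈ C.support) {x : Site 2}
    (hx : x ∉ Rect.box x₀ x₁ y₀ y₁ \ {bx x_s (y₀ + 1)}) :
    wind (fun t : ℝ => (poly (bx x₀ y₀) C.support.tail).extend t - pt x) = 0 := by
  set P := poly (bx x₀ y₀) C.support.tail with hP
  have hsupp : ∀ y ∈ C.support, wind (fun t : ℝ => P.extend t - pt y) = 0 := fun y hy => by
    apply wind_eq_zero_of_mem_range
    have hmem : pt y ∈ pt (bx x₀ y₀) :: C.support.tail.map pt := by
      rw [← List.map_cons, C.cons_tail_support]; exact List.mem_map_of_mem hy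
    exact mem_range_polylineFrom _ _ hmem
  by_cases hxs : x = bx x_s (y₀ + 1)
  · rw [hxs]; exact hsupp _ hs
  have hxb : x ∉ Rect.box x₀ x₁ y₀ y₁ := fun h => hx ⟨h, hxs⟩
  by_cases hcl : (x₀ ≤ x 0 ∧ x 0 ≤ x₁) ∧ (y₀ ≤ x 1 ∧ x 1 ≤ y₁)
  · -- a wall lattice point
    have hw : x 0 = x₀ ∨ x 0 = x₁ ∨ x 1 = y₀ ∨ x 1 = y₁ := by
      simp only [Rect.box, mem_setOf_eq] at hxb; omega
    have hmem := hcomp (x 0) (x 1) hcl.1.1 hcl.1.2 hcl.2.1 hcl.2.2 hw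
    rw [← eq_bx x] at hmem
    exact hsupp x hmem
  · -- strictly outside the rectangle
    by_cases hr : pt x ∈ range P
    · exact wind_eq_zero_of_mem_range P hr
    rw [wind_eq_wind_probeL C hr, pt_re, pt_im, Int.floor_intCast, Int.floor_intCast]
    have hbox : ∀ y ∈ bx x₀ y₀ :: C.support.tail, (x₀ ≤ y 0 ∧ y 0 ≤ x₁) ∧ (y₀ ≤ y 1 ∧ y 1 ≤ y₁) := by
      rw [C.cons_tail_support]; exact hb
    exact wind_poly_probeL_eq_zero_of_not_mem _ _ (poly_fst_walk C) hbox (by omega)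

/-- **The mesh vertices of the notched-box domain are exactly `box ∖ {s}`.** [folklore] -/
theorem meshVertices_eq (hb : ∀ x ∈ C.support, (x₀ ≤ x 0 ∧ x 0 ≤ x₁) ∧ (y₀ ≤ x 1 ∧ x 1 ≤ y₁))
    (hcomp : ∀ i j : ℤ, x₀ ≤ i → i ≤ x₁ → y₀ ≤ j → j ≤ y₁ → (i = x₀ ∨ i = x₁ ∨ j = y₀ ∨ j = y₁) →
      bx i j ∈ C.support)
    (hs : bx x_s (y₀ + 1) ∈ C.support)
    (hch : List.IsChain (fun p q : Site 2 => ((p 1 = y₀ ∧ q 1 = y₀) ∨ (p 0 = x₁ ∧ q 0 = x₁) ∨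
      (p 1 = y₁ ∧ q 1 = y₁) ∨ (p 0 = x₀ ∧ q 0 = x₀)) ∨
      (p 0 = x_s ∧ q 0 = x_s ∧ p 1 ≤ y₀ + 1 ∧ q 1 ≤ y₀ + 1)) (bx x₀ y₀ :: C.support.tail))
    (hwin : ∀ m k : ℤ, x₀ ≤ m → m < x₁ → y₀ ≤ k → k < y₁ →
      wind (fun t : ℝ => (poly (bx x₀ y₀) C.support.tail).extend t - probeL m k) = 1) :
    meshVertices (Rect.Ω C) 1 = Rect.box x₀ x₁ y₀ y₁ \ {bx x_s (y₀ + 1)} := by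
  ext x
  rw [mem_meshVertices_iff, meshPoint_one]
  constructor
  · intro h
    by_contra hx
    simp only [Rect.Ω, mem_setOf_eq, Rect.C_loop_apply] at h
    exact h (wind_pt_eq_zero hb hcomp hs hx)
  · intro hx
    simp only [Rect.Ω, mem_setOf_eq, Rect.C_loop_apply]
    rw [wind_pt_eq_one hch hwin hx]
    exact one_ne_zero

/-- The closed unit segment between lattice neighbours of `box ∖ {s}` misses the trace: it lies in
the open rectangle, and meets the spur line only if one of its endpoints is `s`. [folklore] -/
theorem segment_subset_compl_range
    (hch : List.IsChain (fun p q : Site 2 => ((p 1 = y₀ ∧ q 1 = y₀) ∨ (p 0 = x₁ ∧ q 0 = x₁) ∨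
      (p 1 = y₁ ∧ q 1 = y₁) ∨ (p 0 = x₀ ∧ q 0 = x₀)) ∨
      (p 0 = x_s ∧ q 0 = x_s ∧ p 1 ≤ y₀ + 1 ∧ q 1 ≤ y₀ + 1)) (bx x₀ y₀ :: C.support.tail))
    {x y : Site 2} (hx : x ∈ Rect.box x₀ x₁ y₀ y₁ \ {bx x_s (y₀ + 1)})
    (hy : y ∈ Rect.box x₀ x₁ y₀ y₁ \ {bx x_s (y₀ + 1)}) (hxy : (zdGraph 2).Adj x y) :
    segment ℝ (pt x) (pt y) ⊆ (range (poly (bx x₀ y₀) C.support.tail))ᶜ := by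
  intro z hz hr
  have hzR : z ∈ Rect.Rint x₀ x₁ y₀ y₁ :=
    Rect.convex_Rint.segment_subset (Rect.pt_mem_Rint_of_box hx.1) (Rect.pt_mem_Rint_of_box hy.1) hz
  rcases range_subset hch hr with h | ⟨hre, him⟩
  · exact Rect.Cbd_subset_compl_Rint h hzR
  obtain ⟨-, h3, -⟩ := hzR
  have hxs : x ≠ bx x_s (y₀ + 1) := fun h => hx.2 h
  have hys : y ≠ bx x_s (y₀ + 1) := fun h => hy.2 h
  obtain ⟨⟨-, -⟩, hx3, -⟩ := hx.1
  obtain ⟨⟨-, -⟩, hy3, -⟩ := hy.1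
  rcases adj_cases hxy with ⟨h0, h1⟩ | ⟨h0, h1⟩ | ⟨h1, h0⟩ | ⟨h1, h0⟩
  · -- `y` is East of `x`
    have hzim : z.im = x 1 := im_eq_of_mem_segment h1 hz
    obtain ⟨hlo, hhi⟩ := re_mem_of_mem_segment hz
    rw [pt_re, pt_re, h0] at hlo hhi
    push_cast at hlo hhi
    rw [min_eq_left (by linarith), hre] at hlo
    rw [max_eq_right (by linarith), hre] at hhi
    rw [hzim] at him
    have e1 : x 0 ≤ x_s := by exact_mod_cast hlo
    have e2 : x_s ≤ x 0 + 1 := by exact_mod_cast hhi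
    have e3 : x 1 ≤ y₀ + 1 := by exact_mod_cast him
    rcases (show x_s = x 0 ∨ x_s = x 0 + 1 by omega) with h | h
    · exact hxs (by rw [eq_bx x]; congr 1 <;> omega)
    · exact hys (by rw [eq_bx y]; congr 1 <;> omega)
  · -- `y` is West of `x`
    have hzim : z.im = x 1 := im_eq_of_mem_segment h1 hz
    obtain ⟨hlo, hhi⟩ := re_mem_of_mem_segment hz
    rw [pt_re, pt_re, h0] at hlo hhi
    push_cast at hlo hhi
    rw [min_eq_right (by linarith), hre] at hlo
    rw [max_eq_left (by linarith), hre] at hhi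
    rw [hzim] at him
    have e1 : y 0 ≤ x_s := by exact_mod_cast hlo
    have e2 : x_s ≤ y 0 + 1 := by exact_mod_cast hhi
    have e3 : x 1 ≤ y₀ + 1 := by exact_mod_cast him
    rcases (show x_s = y 0 ∨ x_s = y 0 + 1 by omega) with h | h
    · exact hys (by rw [eq_bx y]; congr 1 <;> omega)
    · exact hxs (by rw [eq_bx x]; congr 1 <;> omega)
  · -- `y` is North of `x`
    have hzre : z.re = x 0 := re_eq_of_mem_segment h0 hz
    rw [hzre, Int.cast_inj] at hre
    obtain ⟨hlo, -⟩ := im_mem_of_mem_segment hz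
    rw [pt_im, pt_im, h1] at hlo
    push_cast at hlo
    rw [min_eq_left (by linarith)] at hlo
    have e3 : x 1 ≤ y₀ + 1 := by exact_mod_cast hlo.trans him
    exact hxs (by rw [eq_bx x]; exact congrArg₂ bx hre (by omega))
  · -- `y` is South of `x`
    have hzre : z.re = x 0 := re_eq_of_mem_segment h0 hz
    rw [hzre, Int.cast_inj] at hre
    obtain ⟨hlo, -⟩ := im_mem_of_mem_segment hz
    rw [pt_im, pt_im, h1] at hlo
    push_cast at hlo
    rw [min_eq_right (by linarith)] at hlo
    have e3 : y 1 ≤ y₀ + 1 := by exact_mod_cast hlo.trans him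
    exact hys (by rw [eq_bx y]; congr 1 <;> omega)

/-- **Lattice neighbours of the notched box are mesh-adjacent** in the notched-box domain: the
winding number is `1` along the whole closed unit segment between them. [folklore] -/
theorem meshGraph_adj
    (hch : List.IsChain (fun p q : Site 2 => ((p 1 = y₀ ∧ q 1 = y₀) ∨ (p 0 = x₁ ∧ q 0 = x₁) ∨
      (p 1 = y₁ ∧ q 1 = y₁) ∨ (p 0 = x₀ ∧ q 0 = x₀)) ∨
      (p 0 = x_s ∧ q 0 = x_s ∧ p 1 ≤ y₀ + 1 ∧ q 1 ≤ y₀ + 1)) (bx x₀ y₀ :: C.support.tail))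
    (hwin : ∀ m k : ℤ, x₀ ≤ m → m < x₁ → y₀ ≤ k → k < y₁ →
      wind (fun t : ℝ => (poly (bx x₀ y₀) C.support.tail).extend t - probeL m k) = 1)
    {x y : Site 2} (hx : x ∈ Rect.box x₀ x₁ y₀ y₁ \ {bx x_s (y₀ + 1)})
    (hy : y ∈ Rect.box x₀ x₁ y₀ y₁ \ {bx x_s (y₀ + 1)}) (hxy : (zdGraph 2).Adj x y) :
    (meshGraph (Rect.Ω C) 1).Adj x y := by
  refine meshGraph_adj_iff.2 ⟨hxy, ?_⟩
  rw [meshPoint_one, meshPoint_one]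
  refine Subset.trans (fun z hz => ?_) subset_closure
  have hseg : segment ℝ (pt x) z ⊆ (range (poly (bx x₀ y₀) C.support.tail))ᶜ :=
    ((convex_segment (pt x) (pt y)).segment_subset (left_mem_segment _ _ _) hz).trans
      (segment_subset_compl_range hch hx hy hxy)
  simp only [Rect.Ω, mem_setOf_eq, Rect.C_loop_apply]
  rw [wind_eq_of_segment C hseg, wind_pt_eq_one hch hwin hx]
  exact one_ne_zero

end Winding

/-! ## The mesh graph on the notched box is connected -/

section Mesh

variable {x₀ x₁ y₀ y₁ x_s : ℤ} {Ω' : Set ℂ}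

/-- **The mesh graph on `box ∖ {s}` is connected** when `y₀ + 2 < y₁`: every site is joined up its
column to the top row `y = y₁ - 1` (the notch `s` is on the bottom row), and the top row is a path;
for any `Ω'` whose mesh vertices are `box ∖ {s}` and in which lattice neighbours of `box ∖ {s}` are
mesh-adjacent. [folklore] -/
theorem preconnected (hy : y₀ + 2 < y₁)
    (hV : meshVertices Ω' 1 = Rect.box x₀ x₁ y₀ y₁ \ {bx x_s (y₀ + 1)})
    (hA : ∀ x y : Site 2, x ∈ Rect.box x₀ x₁ y₀ y₁ \ {bx x_s (y₀ + 1)} →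
      y ∈ Rect.box x₀ x₁ y₀ y₁ \ {bx x_s (y₀ + 1)} → (zdGraph 2).Adj x y → (meshGraph Ω' 1).Adj x y) :
    (meshVertexGraph Ω' 1).Preconnected := by
  set G := meshVertexGraph Ω' 1 with hG
  have hmem : ∀ i j : ℤ, x₀ < i → i < x₁ → y₀ < j → j < y₁ → ¬ (i = x_s ∧ j = y₀ + 1) →
      bx i j ∈ Rect.box x₀ x₁ y₀ y₁ \ {bx x_s (y₀ + 1)} := by
    intro i j h1 h2 h3 h4 h5
    refine ⟨⟨⟨h1, h2⟩, h3, h4⟩, fun h => h5 ?_⟩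
    rw [mem_singleton_iff] at h
    exact ⟨by simpa using congrFun h 0, by simpa using congrFun h 1⟩
  by_cases hne : x₀ + 1 < x₁
  swap
  · intro u v
    exfalso
    have hu : (u : Site 2) ∈ Rect.box x₀ x₁ y₀ y₁ \ {bx x_s (y₀ + 1)} := hV ▸ u.2
    obtain ⟨⟨h1, h2⟩, -, -⟩ := hu.1
    omega
  have h00 : bx (x₀ + 1) (y₁ - 1) ∈ meshVertices Ω' 1 := by
    rw [hV]; exact hmem _ _ (by omega) hne (by omega) (by omega) (by omega)
  -- the top row
  have hrow : ∀ k : ℕ, x₀ + 1 + k < x₁ →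
      ∃ h : bx (x₀ + 1 + k) (y₁ - 1) ∈ meshVertices Ω' 1,
        G.Reachable ⟨bx (x₀ + 1) (y₁ - 1), h00⟩ ⟨_, h⟩ := by
    intro k hk
    induction k with
    | zero => exact ⟨by simpa using h00, by simp⟩
    | succ k ih =>
      obtain ⟨hk', hr⟩ := ih (by push_cast at hk ⊢; omega)
      have hm : bx (x₀ + 1 + (k + 1 : ℕ)) (y₁ - 1) ∈ meshVertices Ω' 1 := by
        rw [hV]; exact hmem _ _ (by push_cast; omega) hk (by omega) (by omega) (by omega)
      refine ⟨hm, hr.trans (SimpleGraph.Adj.reachable ?_)⟩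
      simp only [hG, SimpleGraph.comap_adj, Function.Embedding.coe_subtype]
      exact hA _ _ (hV ▸ hk') (hV ▸ hm) (adj_bx _ _ _ _ (Or.inl ⟨by push_cast; ring, rfl⟩))
  -- down the columns
  have hcol : ∀ (i k : ℕ), x₀ + 1 + i < x₁ → y₀ < y₁ - 1 - k →
      ¬ (x₀ + 1 + i = x_s ∧ y₁ - 1 - k = y₀ + 1) →
      ∃ h : bx (x₀ + 1 + i) (y₁ - 1 - k) ∈ meshVertices Ω' 1,
        G.Reachable ⟨bx (x₀ + 1) (y₁ - 1), h00⟩ ⟨_, h⟩ := by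
    intro i k hi hk hs
    induction k with
    | zero => obtain ⟨h, hr⟩ := hrow i hi; exact ⟨by simpa using h, by simpa using hr⟩
    | succ k ih =>
      obtain ⟨hk', hr⟩ := ih (by push_cast at hk ⊢; omega) (by push_cast at hk ⊢; omega)
      have hm : bx (x₀ + 1 + i) (y₁ - 1 - (k + 1 : ℕ)) ∈ meshVertices Ω' 1 := by
        rw [hV]; exact hmem _ _ (by omega) hi hk (by push_cast; omega) hs
      refine ⟨hm, hr.trans (SimpleGraph.Adj.reachable ?_)⟩
      simp only [hG, SimpleGraph.comap_adj, Function.Embedding.coe_subtype]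
      exact hA _ _ (hV ▸ hk') (hV ▸ hm)
        (adj_bx _ _ _ _ (Or.inr (Or.inr (Or.inr ⟨by push_cast; ring, rfl⟩))))
  have hreach : ∀ v : meshVertices Ω' 1, G.Reachable ⟨bx (x₀ + 1) (y₁ - 1), h00⟩ v := by
    rintro ⟨v, hv⟩
    have hv' := hv
    rw [hV] at hv'
    obtain ⟨⟨h1, h2⟩, h3, h4⟩ := hv'.1
    have hvs : ¬ (v 0 = x_s ∧ v 1 = y₀ + 1) := by
      rintro ⟨e0, e1⟩
      exact hv'.2 (by rw [mem_singleton_iff, eq_bx v, e0, e1])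
    obtain ⟨i, hi⟩ : ∃ i : ℕ, (i : ℤ) = v 0 - (x₀ + 1) :=
      ⟨(v 0 - (x₀ + 1)).toNat, Int.toNat_of_nonneg (by omega)⟩
    obtain ⟨k, hk⟩ : ∃ k : ℕ, (k : ℤ) = y₁ - 1 - v 1 :=
      ⟨(y₁ - 1 - v 1).toNat, Int.toNat_of_nonneg (by omega)⟩
    obtain ⟨h, hr⟩ := hcol i k (by omega) (by omega) (by omega)
    have heq : bx (x₀ + 1 + i) (y₁ - 1 - k) = v := by
      rw [eq_bx v]; congr 1 <;> omega
    have hsub : (⟨v, hv⟩ : meshVertices Ω' 1) = ⟨bx (x₀ + 1 + i) (y₁ - 1 - k), h⟩ :=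
      Subtype.ext heq.symm
    rw [hsub]
    exact hr
  exact fun u v => (hreach u).symm.trans (hreach v)

/-- **The discrete domain of such an `Ω'` is the whole notched box.** [folklore] -/
theorem meshDomain_eq (hy : y₀ + 2 < y₁)
    (hV : meshVertices Ω' 1 = Rect.box x₀ x₁ y₀ y₁ \ {bx x_s (y₀ + 1)})
    (hA : ∀ x y : Site 2, x ∈ Rect.box x₀ x₁ y₀ y₁ \ {bx x_s (y₀ + 1)} →
      y ∈ Rect.box x₀ x₁ y₀ y₁ \ {bx x_s (y₀ + 1)} → (zdGraph 2).Adj x y → (meshGraph Ω' 1).Adj x y) :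
    meshDomain Ω' 1 = Rect.box x₀ x₁ y₀ y₁ \ {bx x_s (y₀ + 1)} := by
  rw [Literature.Probability.Percolation.meshDomain_eq_meshVertices_of_preconnected
    (preconnected hy hV hA), hV]

/-- **Adjacency in `Ω'_1` is lattice adjacency inside the notched box**, for such an `Ω'`.
[folklore] -/
theorem dAdj_iff (hy : y₀ + 2 < y₁)
    (hV : meshVertices Ω' 1 = Rect.box x₀ x₁ y₀ y₁ \ {bx x_s (y₀ + 1)})
    (hA : ∀ x y : Site 2, x ∈ Rect.box x₀ x₁ y₀ y₁ \ {bx x_s (y₀ + 1)} →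
      y ∈ Rect.box x₀ x₁ y₀ y₁ \ {bx x_s (y₀ + 1)} → (zdGraph 2).Adj x y → (meshGraph Ω' 1).Adj x y)
    (u w : Site 2) :
    (discreteDomainGraph Ω' 1).Adj u w ↔ (zdGraph 2).Adj u w ∧
      u ∈ Rect.box x₀ x₁ y₀ y₁ \ {bx x_s (y₀ + 1)} ∧ w ∈ Rect.box x₀ x₁ y₀ y₁ \ {bx x_s (y₀ + 1)} := by
  rw [discreteDomainGraph_adj_iff, meshDomain_eq hy hV hA]
  constructor
  · rintro ⟨h, hu, hw⟩
    exact ⟨meshGraph_le_zdGraph _ _ h, hu, hw⟩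
  · rintro ⟨h, hu, hw⟩
    exact ⟨hA u w hu hw h, hu, hw⟩

end Mesh

end NotchedBox

/-! ## The registered stub -/

open Literature.Probability.LatticeModels Literature.Probability.RandomPlanarGeometry
open Summit.CriticalPhenomena.SAWScalingLimit.Theorems.LeftRightFKG.Negative (bx pathCross wcross)
open Summit.CriticalPhenomena.SAWScalingLimit.Theorems.LeftRightFKG.CornerLoc

/-- **Registered stub `stub_notchedBoxWalk` (tool T9b).** Every NOTCHED BOX is a crux domain: for
walls `x₀ < x_s < x₁`, `y₀ + 2 < y₁` there is a closed lattice walk `C` based at `(x₀, y₀)` (the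
boundary walk of the rectangle with the unit spur `(x_s, y₀) → (x_s, y₀ + 1) → (x_s, y₀)` spliced
in) with `(x_s - 1, y₀)` and the spur tip `(x_s, y₀ + 1)` on it, whose discrete domain
`meshDomain (dom C 1) 1` is the open box minus the notch site and whose adjacency in
`discreteDomainGraph (dom C 1) 1` is lattice adjacency inside that set. [folklore] -/
theorem stub_notchedBoxWalk : ∀ (x₀ x₁ y₀ y₁ x_s : ℤ), x₀ < x_s → x_s < x₁ → y₀ + 2 < y₁ →
    ∃ C : (zdGraph 2).Walk (bx x₀ y₀) (bx x₀ y₀),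
      bx (x_s - 1) y₀ ∈ C.support ∧ bx x_s (y₀ + 1) ∈ C.support ∧
      meshDomain (dom C 1) 1 = Negative.Rect.box x₀ x₁ y₀ y₁ \ {bx x_s (y₀ + 1)} ∧
      (∀ u w : Site 2, (discreteDomainGraph (dom C 1) 1).Adj u w ↔
        (zdGraph 2).Adj u w ∧ u ∈ Negative.Rect.box x₀ x₁ y₀ y₁ \ {bx x_s (y₀ + 1)} ∧
          w ∈ Negative.Rect.box x₀ x₁ y₀ y₁ \ {bx x_s (y₀ + 1)}) := by
  intro x₀ x₁ y₀ y₁ x_s hs₀ hs₁ hy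
  obtain ⟨C, ha, hs, hb, hcomp, hch, hwin⟩ :=
    stub_notchedBoxWalkAux x₀ x₁ y₀ y₁ x_s hs₀ hs₁ hy
  have hV : meshVertices (dom C 1) 1 = Negative.Rect.box x₀ x₁ y₀ y₁ \ {bx x_s (y₀ + 1)} :=
    NotchedBox.meshVertices_eq hb hcomp hs hch hwin
  have hA : ∀ x y : Site 2, x ∈ Negative.Rect.box x₀ x₁ y₀ y₁ \ {bx x_s (y₀ + 1)} →
      y ∈ Negative.Rect.box x₀ x₁ y₀ y₁ \ {bx x_s (y₀ + 1)} → (zdGraph 2).Adj x y →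
      (meshGraph (dom C 1) 1).Adj x y :=
    fun x y hx hy' hxy => NotchedBox.meshGraph_adj hch hwin hx hy' hxy
  exact ⟨C, ha, hs, NotchedBox.meshDomain_eq hy hV hA, NotchedBox.dAdj_iff hy hV hA⟩

end Summit.CriticalPhenomena.SAWScalingLimit.Theorems.LeftRightFKG.Families
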